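import Summits.NavierStokesRegularity.NavierStokesRegularity.Theorems.UnthreadedDoorCellFluxCellTameOfBranches
import Summits.NavierStokesRegularity.NavierStokesRegularity.Theorems.UnthreadedDoorCellFluxTameOfDecay
import Summits.NavierStokesRegularity.NavierStokesRegularity.Theorems.UnthreadedDoorCellFluxWindowDecayOffNullInt
import Summits.NavierStokesRegularity.NavierStokesRegularity.Theorems.UnthreadedDoorCellFluxTimeLipschitz
import Summits.NavierStokesRegularity.NavierStokesRegularity.Theorems.UnthreadedDoorCellFluxClusterFluxLeVorticity
import HarnessLib

/-!
# Route `UnthreadedDoor`, crux `PoloidalLiouville` (stmt-NavierStokesRegularity-1222), WALL W1 — crux idea «cell-flux» (ns-idea-14):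
# END STATE BY NAME of the cell-flux chain: K3^Σ `CellTameScalarLiouvilleTypeI` modulo {hO, Σ-1, Σ-2, Σ-0bR₂}

Bookkeeping file (theorems only, no new statements; `--supports stmt-NavierStokesRegularity-1222 --as helper`).  The composition
`cellTame_of_stubs` of `Cruxes/PoloidalLiouville/CellFluxSketch.lean` (v1.2.15) run Theorems-side over the landed decls: Σ-5 modulo F1
(`CellFlux.cellTame_of_branches_of_signSetFinite`, p731349) ∘ Σ-5a (`unthreadedGaugeRigidity`, p720399) ∘ Σ-Z (`zonalTypeIScalarLiouville`) ∘ Σ-4′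
(`cellTameAnalytic_of_decayIntegrable`, p723451) ∘ Σ-3′ (`clusterFluxWindowDecayOffNullInt_of`, p726682) ∘ Σ-0a (`clusterFluxLeVorticity`, p717414) ∘ Σ-0b′
(`clusterFluxNearCentreLinked_of_lipschitz`, p726325 = Σ-0bR₁ p718757 + Σ-0bR₂) ∘ Σ-0e (`clusterFluxTimeLipschitz_of_lipschitz`, p727700) ∘ AE-2′
(`halfLineOUDecayOffNullClosed_holds`, p687414).  ★ `cellTameScalarLiouvilleTypeI_of_cellFluxResidue (hO) (hS1 : HeadClusterRule) (hS2 : ClusterFluxOneSidedLawOffNull)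
(hR₂ : ClusterFluxNearCentreLipschitz) : CellTameScalarLiouvilleTypeI` — **K3^Σ holds modulo exactly four named items** (the o-minimality fact behind F1,
the head-cluster rule Σ-1, its one-sided law Σ-2, the near-centre Lipschitz control Σ-0bR₂), and ★ `cellTameScalarLiouvilleTypeI_of_cellFluxResidue'`, the
same with the F1 body in place of `hO`.  HONEST LABEL: a REDUCTION naming the residue; K3^Σ is a stratum statement below W1 (its complement
`ComplexSheetResidualTypeI` is wall-class); none of the four items is claimed; ⟨1222⟩, W1 and NS regularity stay OPEN.  ARM A `pub/ns-exp-scalarLiouville` g8.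
-/

noncomputable section

-- the summit and its single sub-problem share the name (CONVENTIONS §1)
set_option linter.dupNamespace false

open Set Function Filter Topology

namespace Summit.NavierStokesRegularity.NavierStokesRegularity.Theorems.PoloidalLiouville.CellFlux

/-- ★ **K3^Σ modulo {F1, Σ-1, Σ-2, Σ-0bR₂}** (F1 = the body of `BierstoneMilman1988_signSet_components_finite` of the IndicatrixSketch §F, verbatim). [folklore] -/
theorem cellTameScalarLiouvilleTypeI_of_cellFluxResidue'
    (hF1 : ∀ (E : Type) [NormedAddCommGroup E] [NormedSpace ℝ E] [FiniteDimensional ℝ E] (U : Set E) (h g : E → ℝ),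
      IsOpen U → AnalyticOnNhd ℝ h U → AnalyticOnNhd ℝ g U → IsCompact {x | x ∈ U ∧ h x = 0} →
        (connectedComponentIn {x | x ∈ U ∧ h x = 0 ∧ g x = 0} '' {x | x ∈ U ∧ h x = 0 ∧ g x = 0}).Finite ∧
        (connectedComponentIn {x | x ∈ U ∧ h x = 0 ∧ g x ≠ 0} '' {x | x ∈ U ∧ h x = 0 ∧ g x ≠ 0}).Finite)
    (hS1 : HeadClusterRule) (hS2 : ClusterFluxOneSidedLawOffNull) (hR₂ : ClusterFluxNearCentreLipschitz) :
    CellTameScalarLiouvilleTypeI :=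
  cellTame_of_branches_of_signSetFinite hF1 unthreadedGaugeRigidity zonalTypeIScalarLiouville
    (cellTameAnalytic_of_decayIntegrable hS1
      (clusterFluxWindowDecayOffNullInt_of hS2 clusterFluxLeVorticity (clusterFluxNearCentreLinked_of_lipschitz hR₂)
        (clusterFluxTimeLipschitz_of_lipschitz hR₂) halfLineOUDecayOffNullClosed_holds))

/-- ★ **K3^Σ modulo {«`ℝ_an,exp` is o-minimal», Σ-1, Σ-2, Σ-0bR₂}** — the cell-flux chain's end state by name. [folklore] -/
theorem cellTameScalarLiouvilleTypeI_of_cellFluxResidue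
    (hO : Literature.ModelTheory.ExponentialFields.VandendriesMiller1994_realAnExp_isOMinimal)
    (hS1 : HeadClusterRule) (hS2 : ClusterFluxOneSidedLawOffNull) (hR₂ : ClusterFluxNearCentreLipschitz) :
    CellTameScalarLiouvilleTypeI :=
  cellTameScalarLiouvilleTypeI_of_cellFluxResidue'
    (Literature.Analysis.Calculus.analyticSignSet_connectedComponents_finite_of_realAnExp_isOMinimal hO) hS1 hS2 hR₂

end Summit.NavierStokesRegularity.NavierStokesRegularity.Theorems.PoloidalLiouville.CellFlux

end
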